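import Summits.ResolutionOfSingularities.ResolutionOfSingularities.Theorems.HilbertSamuelEliminationSigmaMaxModificationsCorridor3SigmaSurfaceBadnessPointCureCross
import HarnessLib

/-!
# [OURS · L1 W4.2] σ-LAYER PHASE B′ — `Corridor3SigmaSurfaceBadnessPointCureDrop`: **`M` STRICTLY DROPS AT THE CURE-POINT STEP** (carrier side) — blowing up a counted
# same-member crossing `x` of an snc configuration of a regular surface: the crossing `x` disappears (`X` drops by at least one, every point of the exceptional divisor being
# filtered by the bad `E`), the component sums agree off `E` and `E` contributes `μ_E = 1`: `M′ + 1 ≤ Σμ + 1 + 2(X − 1) < M`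
# (res-L1-w42-stub-1 DESIGN CHECK 2 (b) «net −1»; crux chain w42 `SigmaMaxModifications` stmt-ResolutionOfSingularities-18506 / conjunct `SigmaMaxModificationsCorridor3`
# stmt-ResolutionOfSingularities-19249; helper of res-L1-w42-stub-1 (gen 6), `--supports stmt-…-19249 --as helper`, counted 0)

HONEST FRAMING. OURS bookkeeping over this seat's `…SurfaceBadnessPointCure` (off-`E` transport), `…PointCureExc` (`η_E`, `compMults_E = [1,1]`), `…PointCureCross`
(`Γ₀` unique through `x`, `ord_x Γ₀ = 2`) and Mathlib `finsum_mem_union` / `finsum_mem_eq_of_bijOn` / `Set.ncard_le_ncard_of_injOn` / `List.sum_lt_sum`. NOTHING here is a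
statement of H. Hironaka's manuscript [Hironaka2017] nor of [CossartJannsenSaito2020]; no named fact. AI-written; AI review is weaker than expert review.

## Contents (namespace `…Theorems.SigmaMaxModificationsCorridor3.Sigma`)

* `not_mem_crossingPts_pointCure_of_base_eq` (points of `E` are not counted), `base_mem_crossingPts_of_mem_crossingPts_pointCure` (off `E`, a counted crossing of the
  cured member maps to a counted crossing `≠ x` of the member), `Boundary.ncard_crossingPts_pointCure_le`, `Boundary.crossingPts_pointCure_comap_pointIdeal` (`= ∅`),
  **`Boundary.crossingCount_pointCure_lt`**.
* `Boundary.codimOnePoints_pointCure_subset`, `Boundary.finite_codimOnePoints_pointCure`, **`Boundary.finsum_compBadness_pointCure_le`** (`Σ′ ≤ Σ + 1`).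
* **`Boundary.badness_pointCure_lt`** — regular integral Noetherian `D` with all points of codimension `≤ 2`, non-zero locally principal traces, `S` snc, `x` a counted
  crossing of `Γ₀ ∈ Γs`, `ρ` a blow-up of `𝓘_x` with `D′` integral locally Noetherian ⇒ `(Γs.pointCure x ρ 𝓘_x).badness < Γs.badness`.

VACUITY SELF-CHECK. On DESIGN CHECK 1's witness (one member with trace `V(xy)`): `M = 2` (one crossing), after the point blow-up `M′ = 1` (`E` shared by `Γ₀′` and the new
member, `μ_E = 1`, no counted crossing), then the cure-curve step along `E` gives `M″ = 0` — the predicted `2 ↦ 1 ↦ 0`.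
-/

noncomputable section

set_option linter.dupNamespace false -- mandated namespace of this single-conjunct summit

open CategoryTheory AlgebraicGeometry TopologicalSpace IsLocalRing
open Summit.ResolutionOfSingularities.ResolutionOfSingularities.Theorems.CampaignW42
open Literature.AlgebraicGeometry.Resolution Literature.RingTheory.HilbertSamuel

namespace Summit.ResolutionOfSingularities.ResolutionOfSingularities.Theorems.SigmaMaxModificationsCorridor3.Sigma

universe u

open Scheme.IdealSheafData

section Drop

variable {D D' : Scheme.{u}} [IsIntegral D] [IsNoetherian D] [IsLocallyNoetherian D'] [IsIntegral D'] {x : D} {hxc : IsClosed ({x} : Set D)} {ρ : D' ⟶ D}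
  (hρ : IsBlowup ρ (vanishingIdeal ⟨{x}, hxc⟩)) (hreg : Scheme.IsRegular D) {Γs : Boundary D} (hne : ∀ Γ ∈ Γs, Γ ≠ ⊥)
  (hlp : ∀ Γ ∈ Γs, IsLocallyPrincipal Γ) (hS : IsStrictNormalCrossingsDivisor D Γs.divisorSet) (h2 : ∀ y : D, Order.coheight y ≤ 2)
  {Γ₀ : D.IdealSheafData} (hΓ₀ : Γ₀ ∈ Γs) (hx : x ∈ Γs.crossingPts Γ₀)

omit [IsIntegral D] [AlgebraicGeometry.IsNoetherian D] in
/-- The codimension of a counted crossing is two. [folklore] -/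
theorem coheight_eq_two_of_mem_crossingPts (h2 : ∀ y : D, Order.coheight y ≤ 2) {Γs : Boundary D} {Γ₀ : D.IdealSheafData} {x : D} (hx : x ∈ Γs.crossingPts Γ₀) :
    Order.coheight x = 2 := by
  obtain ⟨⟨ζ₁, h₁, ζ₂, h₂', hne12, hs₁, hs₂⟩, -⟩ := hx
  exact coheight_eq_two_of_two_specializes h2 h₁.2 h₂'.2 hne12 hs₁ hs₂

include hρ hreg hne hlp hS h2 hΓ₀ hx in
/-- **POINTS OF THE EXCEPTIONAL DIVISOR ARE NEVER COUNTED**: `η_E` is a codimension-one point of the new configuration through every point of `E`, and `E` is bad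
(`compMults_E = [1, 1]`). [folklore] -/
theorem not_mem_crossingPts_pointCure_of_base_eq {y' : D'} (hy' : ρ.base y' = x) (J : D'.IdealSheafData) :
    y' ∉ (Γs.pointCure x ρ (vanishingIdeal ⟨{x}, hxc⟩)).crossingPts J := by
  have hx2 := coheight_eq_two_of_mem_crossingPts h2 hx
  rintro ⟨-, hfilt⟩
  apply hfilt (excPoint hρ hreg hx2) (excPoint_mem_codimOnePoints_pointCure hρ hreg hx2 Γs) ((specializes_excPoint_iff hρ hreg hx2).mpr hy')
  rw [Boundary.compMults_pointCure_excPoint hρ hreg hx2 (hne Γ₀ hΓ₀) (filter_mem_support_eq_singleton_of_mem_crossingPts hreg hne hlp hS h2 hΓ₀ hx)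
    (toNat_idealOrder_eq_two_of_mem_crossingPts hreg hne hlp hS h2 hΓ₀ hx)]
  decide

include hρ hreg hne hlp hS h2 hΓ₀ hx in
/-- **OFF `E`, A COUNTED CROSSING OF THE CURED MEMBER LIES OVER A COUNTED CROSSING OF THE MEMBER, OTHER THAN `x`.** [folklore] -/
theorem base_mem_crossingPts_of_mem_crossingPts_pointCure {Γ : D.IdealSheafData} {y' : D'}
    (hy' : y' ∈ (Γs.pointCure x ρ (vanishingIdeal ⟨{x}, hxc⟩)).crossingPts (pointCureMember x ρ (vanishingIdeal ⟨{x}, hxc⟩) Γ)) :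
    ρ.base y' ∈ Γs.crossingPts Γ ∧ ρ.base y' ≠ x := by
  have hPx := coe_support_pointIdeal hxc
  have hx2 := coheight_eq_two_of_mem_crossingPts h2 hx
  have hyx : ρ.base y' ≠ x := fun h => not_mem_crossingPts_pointCure_of_base_eq hρ hreg hne hlp hS h2 hΓ₀ hx h _ hy'
  obtain ⟨⟨ζ₁, h₁, ζ₂, h₂', hne12, hs₁, hs₂⟩, hfilt⟩ := hy'
  -- the pair lies off `E`
  have hoff : ∀ {ζ' : D'}, ζ' ⤳ y' → ρ.base ζ' ≠ x := by
    intro ζ' hs h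
    apply hyx
    have := hs.map ρ.continuous
    rw [h, specializes_iff_mem_closure, hxc.closure_eq, Set.mem_singleton_iff] at this
    exact this
  refine ⟨⟨⟨ρ.base ζ₁, (mem_divisorialPoints_pointCureMember_iff_of_ne hρ hPx Γ (hoff hs₁)).mp h₁, ρ.base ζ₂,
    (mem_divisorialPoints_pointCureMember_iff_of_ne hρ hPx Γ (hoff hs₂)).mp h₂',
    fun h => hne12 (eq_of_base_eq_of_ne hρ hPx (hoff hs₁) (hoff hs₂) h), hs₁.map ρ.continuous, hs₂.map ρ.continuous⟩, fun η hη hηs => ?_⟩, hyx⟩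
  -- the filter: a codimension-one point `η` of `S` through `ρ y'` lifts off `E`
  have hηx : η ≠ x := fun e => by
    have h1 : Order.coheight x = 1 := e ▸ hη.2
    rw [hx2] at h1; exact absurd h1 (by decide)
  obtain ⟨η', hη'⟩ := exists_base_eq_of_ne hρ hPx hηx
  have hη'x : ρ.base η' ≠ x := by rw [hη']; exact hηx
  have h1 := hfilt η' ((Boundary.mem_codimOnePoints_pointCure_iff_of_ne hρ hPx Γs hη'x).mpr (hη' ▸ hη))
    ((specializes_iff_of_ne hρ hPx hη'x hyx).mp (hη'.symm ▸ hηs))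
  rwa [Boundary.compMults_pointCure_of_ne hρ hPx Γs hη'x, hη'] at h1

include hρ hreg hne hlp hS h2 hΓ₀ hx in
/-- **THE NEW CROSSING SET OF A CURED MEMBER IS NO BIGGER THAN THE OLD ONE MINUS `x`.** [folklore] -/
theorem Boundary.ncard_crossingPts_pointCure_le {Γ : D.IdealSheafData} (hΓ : Γ ∈ Γs) :
    ((Γs.pointCure x ρ (vanishingIdeal ⟨{x}, hxc⟩)).crossingPts (pointCureMember x ρ (vanishingIdeal ⟨{x}, hxc⟩) Γ)).ncard ≤ (Γs.crossingPts Γ \ {x}).ncard := by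
  have hPx := coe_support_pointIdeal hxc
  refine Set.ncard_le_ncard_of_injOn (fun y' => ρ.base y') (fun y' hy' => ?_) (fun y₁ h₁ y₂ h₂ h => ?_)
    ((Boundary.crossingPts_finite_of_coheight_le_two h2 (hne Γ hΓ)).subset Set.sdiff_subset)
  · obtain ⟨h, hx'⟩ := base_mem_crossingPts_of_mem_crossingPts_pointCure hρ hreg hne hlp hS h2 hΓ₀ hx hy'
    exact ⟨h, hx'⟩
  · exact eq_of_base_eq_of_ne hρ hPx (base_mem_crossingPts_of_mem_crossingPts_pointCure hρ hreg hne hlp hS h2 hΓ₀ hx h₁).2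
      (base_mem_crossingPts_of_mem_crossingPts_pointCure hρ hreg hne hlp hS h2 hΓ₀ hx h₂).2 h

omit [AlgebraicGeometry.IsNoetherian D] [IsLocallyNoetherian D'] in
include hρ hreg hx in
/-- **THE NEW MEMBER HAS NO CROSSINGS** (its only divisorial point is `η_E`). [folklore] -/
theorem Boundary.crossingPts_pointCure_comap_pointIdeal (h2 : ∀ y : D, Order.coheight y ≤ 2) :
    (Γs.pointCure x ρ (vanishingIdeal ⟨{x}, hxc⟩)).crossingPts ((vanishingIdeal ⟨{x}, hxc⟩).comap ρ) = ∅ := by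
  have hx2 := coheight_eq_two_of_mem_crossingPts h2 hx
  have hPx := coe_support_pointIdeal hxc
  ext y'
  simp only [Set.mem_empty_iff_false, iff_false]
  rintro ⟨⟨ζ₁, h₁, ζ₂, h₂', hne12, -, -⟩, -⟩
  have hb : ∀ {ζ' : D'}, ζ' ∈ divisorialPoints ((vanishingIdeal ⟨{x}, hxc⟩).comap ρ) → ζ' = excPoint hρ hreg hx2 := by
    intro ζ' h
    have hζ'x : ρ.base ζ' = x := by
      have := h.1
      rw [← SetLike.mem_coe, Boundary.coe_support_comap, Set.mem_preimage, hPx] at this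
      exact this
    exact eq_excPoint_of_coheight_eq_one hρ hreg hx2 hζ'x h.2 (genericPoint_ne_of_coheight_eq_two hx2)
  exact hne12 ((hb h₁).trans (hb h₂').symm)

include hρ hreg hne hlp hS h2 hΓ₀ hx in
/-- **THE CROSSING COUNT DROPS BY AT LEAST ONE** (`x` itself is lost from `Γ₀`'s crossings). [folklore] -/
theorem Boundary.crossingCount_pointCure_lt : (Γs.pointCure x ρ (vanishingIdeal ⟨{x}, hxc⟩)).crossingCount < Γs.crossingCount := by
  unfold Boundary.crossingCount
  rw [Boundary.pointCure, List.map_append, List.sum_append, List.map_singleton, List.sum_singleton, ← Boundary.pointCure,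
    Boundary.crossingPts_pointCure_comap_pointIdeal hρ hreg hx h2, Set.ncard_empty, add_zero, List.map_map]
  refine List.sum_lt_sum _ _ (fun Γ hΓ => ?_) ⟨Γ₀, hΓ₀, ?_⟩
  · exact (Boundary.ncard_crossingPts_pointCure_le hρ hreg hne hlp hS h2 hΓ₀ hx hΓ).trans (Set.ncard_le_ncard Set.sdiff_subset
      (Boundary.crossingPts_finite_of_coheight_le_two h2 (hne Γ hΓ)))
  · refine lt_of_le_of_lt (Boundary.ncard_crossingPts_pointCure_le hρ hreg hne hlp hS h2 hΓ₀ hx hΓ₀) ?_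
    have hfin := Boundary.crossingPts_finite_of_coheight_le_two (Γs := Γs) h2 (hne Γ₀ hΓ₀)
    have := Set.ncard_sdiff_singleton_add_one hx hfin
    omega

/-! ### The component sums -/

omit [AlgebraicGeometry.IsNoetherian D] [IsLocallyNoetherian D'] in
include hρ hreg hx in
/-- The codimension-one points of the new configuration: those off `E` (over old ones) and possibly `η_E`. [folklore] -/
theorem Boundary.codimOnePoints_pointCure_subset (h2 : ∀ y : D, Order.coheight y ≤ 2) :
    (Γs.pointCure x ρ (vanishingIdeal ⟨{x}, hxc⟩)).codimOnePoints ⊆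
      {y' | ρ.base y' ≠ x ∧ ρ.base y' ∈ Γs.codimOnePoints} ∪ {excPoint hρ hreg (coheight_eq_two_of_mem_crossingPts h2 hx)} := by
  have hx2 := coheight_eq_two_of_mem_crossingPts h2 hx
  have hPx := coe_support_pointIdeal hxc
  intro y' hy'
  by_cases h : ρ.base y' = x
  · exact Or.inr (eq_excPoint_of_coheight_eq_one hρ hreg hx2 h hy'.2 (genericPoint_ne_of_coheight_eq_two hx2))
  · exact Or.inl ⟨h, (Boundary.mem_codimOnePoints_pointCure_iff_of_ne hρ hPx Γs h).mp hy'⟩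

omit [IsLocallyNoetherian D'] in
include hρ hreg hne hx in
/-- The codimension-one points of the new configuration are finitely many. [folklore] -/
theorem Boundary.finite_codimOnePoints_pointCure (h2 : ∀ y : D, Order.coheight y ≤ 2) : ((Γs.pointCure x ρ (vanishingIdeal ⟨{x}, hxc⟩)).codimOnePoints).Finite := by
  have hPx := coe_support_pointIdeal hxc
  refine ((Set.Finite.union ?_ (Set.finite_singleton _))).subset (Boundary.codimOnePoints_pointCure_subset hρ hreg hx h2)
  have hsub : {y' : D' | ρ.base y' ≠ x ∧ ρ.base y' ∈ Γs.codimOnePoints} ⊆ (fun y' => ρ.base y') ⁻¹' Γs.codimOnePoints := fun _ h => h.2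
  refine Set.Finite.subset (Set.Finite.preimage (fun y₁ h₁ y₂ h₂ h => ?_) (Boundary.codimOnePoints_finite hne)) hsub
  have hx2 := coheight_eq_two_of_mem_crossingPts h2 hx
  have hne1 : ∀ {y : D'}, ρ.base y ∈ Γs.codimOnePoints → ρ.base y ≠ x := fun h e => by
    have h1 : Order.coheight x = 1 := e ▸ h.2
    rw [hx2] at h1; exact absurd h1 (by decide)
  exact eq_of_base_eq_of_ne hρ hPx (hne1 h₁) (hne1 h₂) h

include hρ hreg hne hlp hS h2 hΓ₀ hx in
/-- **THE COMPONENT SUM GROWS BY AT MOST ONE** (`= Σμ + μ_E`, `μ_E = 1`): off `E` the new codimension-one points correspond bijectively to the old ones with the same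
multiplicity lists; on `E` only `η_E`, with `compMults = [1, 1]`. [folklore] -/
theorem Boundary.finsum_compBadness_pointCure_le :
    ∑ᶠ ζ' ∈ (Γs.pointCure x ρ (vanishingIdeal ⟨{x}, hxc⟩)).codimOnePoints, (Γs.pointCure x ρ (vanishingIdeal ⟨{x}, hxc⟩)).compBadness ζ' ≤
      (∑ᶠ ζ ∈ Γs.codimOnePoints, Γs.compBadness ζ) + 1 := by
  have hx2 := coheight_eq_two_of_mem_crossingPts h2 hx
  have hPx := coe_support_pointIdeal hxc
  set Γs' := Γs.pointCure x ρ (vanishingIdeal ⟨{x}, hxc⟩) with hΓs'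
  set η := excPoint hρ hreg hx2 with hη
  set A : Set D' := {y' | y' ∈ Γs'.codimOnePoints ∧ ρ.base y' ≠ x} with hA
  set B : Set D' := {y' | y' ∈ Γs'.codimOnePoints ∧ ρ.base y' = x} with hB
  have hfin := Boundary.finite_codimOnePoints_pointCure hρ hreg hne hx h2 (Γs := Γs)
  have hAB : Γs'.codimOnePoints = A ∪ B := by
    ext y'; simp only [hA, hB, Set.mem_union, Set.mem_setOf_eq]; tauto
  have hdisj : Disjoint A B := Set.disjoint_left.mpr fun y' hA' hB' => hA'.2 hB'.2
  have hAfin : A.Finite := hfin.subset fun _ h => h.1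
  have hBfin : B.Finite := hfin.subset fun _ h => h.1
  rw [hAB, finsum_mem_union hdisj hAfin hBfin]
  -- off `E`: bijection with the old codimension-one points
  have hAeq : ∑ᶠ y' ∈ A, Γs'.compBadness y' = ∑ᶠ ζ ∈ Γs.codimOnePoints, Γs.compBadness ζ := by
    refine finsum_mem_eq_of_bijOn (fun y' => ρ.base y') ⟨fun y' hy' => ?_, fun y₁ h₁ y₂ h₂ h => eq_of_base_eq_of_ne hρ hPx h₁.2 h₂.2 h, fun ζ hζ => ?_⟩
      fun y' hy' => ?_
    · exact (Boundary.mem_codimOnePoints_pointCure_iff_of_ne hρ hPx Γs hy'.2).mp hy'.1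
    · have hζx : ζ ≠ x := fun e => by
        have h1 : Order.coheight x = 1 := e ▸ hζ.2
        rw [hx2] at h1; exact absurd h1 (by decide)
      obtain ⟨ζ', hζ'⟩ := exists_base_eq_of_ne hρ hPx hζx
      have hζ'x : ρ.base ζ' ≠ x := by rw [hζ']; exact hζx
      exact ⟨ζ', ⟨(Boundary.mem_codimOnePoints_pointCure_iff_of_ne hρ hPx Γs hζ'x).mpr (hζ' ▸ hζ), hζ'x⟩, hζ'⟩
    · rw [Boundary.compBadness_eq, Boundary.compBadness_eq, Boundary.compMults_pointCure_of_ne hρ hPx Γs hy'.2]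
  rw [hAeq]
  -- on `E`: at most `η_E`, with `μ = 1`
  have hBsub : B ⊆ {η} := fun y' hy' => eq_excPoint_of_coheight_eq_one hρ hreg hx2 hy'.2 hy'.1.2 (genericPoint_ne_of_coheight_eq_two hx2)
  have hBle : ∑ᶠ y' ∈ B, Γs'.compBadness y' ≤ 1 := by
    by_cases hηB : η ∈ B
    · have hBeq : B = {η} := Set.Subset.antisymm hBsub (Set.singleton_subset_iff.mpr hηB)
      rw [hBeq, finsum_mem_singleton, Boundary.compBadness_eq, hΓs', hη,
        Boundary.compMults_pointCure_excPoint hρ hreg hx2 (hne Γ₀ hΓ₀) (filter_mem_support_eq_singleton_of_mem_crossingPts hreg hne hlp hS h2 hΓ₀ hx)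
          (toNat_idealOrder_eq_two_of_mem_crossingPts hreg hne hlp hS h2 hΓ₀ hx)]
      decide
    · have hBeq : B = ∅ := Set.eq_empty_of_forall_notMem fun y' hy' => hηB ((hBsub hy') ▸ hy')
      rw [hBeq, finsum_mem_empty]
      exact Nat.zero_le _
  omega

include hρ hreg hne hlp hS h2 hΓ₀ hx in
/-- **`M` STRICTLY DROPS AT THE CURE-POINT STEP** (carrier side): `(Γs.pointCure x ρ 𝓘_x).badness < Γs.badness`. [folklore] -/
theorem Boundary.badness_pointCure_lt : (Γs.pointCure x ρ (vanishingIdeal ⟨{x}, hxc⟩)).badness < Γs.badness := by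
  unfold Boundary.badness
  have h1 := Boundary.finsum_compBadness_pointCure_le hρ hreg hne hlp hS h2 hΓ₀ hx
  have h2' := Boundary.crossingCount_pointCure_lt hρ hreg hne hlp hS h2 hΓ₀ hx
  omega

end Drop

end Summit.ResolutionOfSingularities.ResolutionOfSingularities.Theorems.SigmaMaxModificationsCorridor3.Sigma

end
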